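import Mathlib
import Literature.Analysis.FunctionSpaces.TranslationAverageApproxIdentity
import HarnessLib

/-!
# `ContinuumLegGivenGap` (stmt-QuantumFields-15828), line `duality-selection-nlo-skewness`:
# approximate identities on `𝓢(ℝᵈ)` (registered stub `stub_approxIdentity`)

Support file for the crux item stmt-QuantumFields-15828 (registered stub `stub_approxIdentity`
of the line `duality-selection-nlo-skewness`, Källén–Lehmann positivity of the truncated OS
two-point function). Smearing a test function `u` with a shrinking mass-one non-negative bump
`φₙ` — the averaging operator `K_{φₙ} u = ∫ φₙ(a) u(· − a) da`
(`SchwartzAverage.translationAverage id φₙ`) — converges back to `u` **in the Schwartz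
topology**, so that continuous functionals (Schwinger functions) pass to the limit.

**Proof.** The Schwartz topology is the seminorm topology (`schwartz_withSeminorms`,
`WithSeminorms.tendsto_nhds`), so it suffices to make every `p_{k,l}(K_{φₙ} u − u)` eventually
`< ε`. The tree lemma `SchwartzAverage.exists_radius_seminorm_translationAverage_sub_le` gives a
radius `R > 0` such that every weight `h` of mass one with `∫‖h‖ ≤ 1` vanishing outside the ball of
radius `R` has `p_{k,l}(K_h u − u) ≤ ε/2`. The three side conditions hold for `h = φₙ` eventually:
mass one is a hypothesis; `φₙ` is real and non-negative, so `‖φₙ‖ = Re φₙ` pointwise and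
`∫‖φₙ‖ = Re ∫ φₙ = 1`; and `tsupport φₙ ⊆ closedBall 0 rₙ` with `rₙ → 0` gives `rₙ < R`
eventually, whence `φₙ a = 0` for `‖a‖ > R`. Hörmander I, Thm. 1.3.2. [folklore]
-/

namespace Summit.QuantumFields.YangMills.Cruxes.ContinuumLegGivenGap.DualitySelectionNloSkewness

open scoped SchwartzMap
open Filter Topology MeasureTheory

/-- A real non-negative Schwartz function of mass one has `L¹` norm at most one (in fact equal to
one): `‖φ x‖ = Re (φ x)` pointwise, so `∫ ‖φ‖ = Re ∫ φ = 1`. [folklore] -/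
theorem integral_norm_le_one_of_nonneg_of_mass_one {d : ℕ} (φ : 𝓢(EuclideanSpace ℝ (Fin d), ℂ))
    (hnn : ∀ x, (φ x).im = 0 ∧ 0 ≤ (φ x).re) (hmass : ∫ x, φ x = 1) :
    ∫ x, ‖φ x‖ ≤ 1 := by
  -- pointwise: `φ x` is the real number `‖φ x‖`
  have hpt : ∀ x, ((‖φ x‖ : ℝ) : ℂ) = φ x := fun x => by
    obtain ⟨him, hre⟩ := hnn x
    have hx : φ x = ((φ x).re : ℂ) := Complex.ext (by simp) (by simp [him])
    rw [hx, Complex.norm_of_nonneg hre]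
  have hint : ((∫ x, ‖φ x‖ : ℝ) : ℂ) = 1 := by
    rw [← integral_complex_ofReal]
    simp_rw [hpt]
    exact hmass
  exact (Complex.ofReal_eq_one.1 hint).le

/-- `stub_approxIdentity` — **approximate identities act as the identity in the limit on `𝓢(ℝᵈ)`**:
for real non-negative mass-one kernels `φₙ` supported in `closedBall 0 rₙ`, `rₙ → 0`, the averaging
operators `K_{φₙ} u = ∫ φₙ(a) u(· − a) da` (`SchwartzAverage.translationAverage id φₙ`) converge to
`u` in the Schwartz topology, seminorm by seminorm, through
`SchwartzAverage.exists_radius_seminorm_translationAverage_sub_le`. Hörmander I, Thm. 1.3.2.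
[folklore] -/
theorem stub_approxIdentity :
    (∀ (d : ℕ) (φ : ℕ → 𝓢(EuclideanSpace ℝ (Fin d), ℂ)) (r : ℕ → ℝ),
      (∀ n x, (φ n x).im = 0 ∧ 0 ≤ (φ n x).re) → (∀ n, ∫ x, φ n x = 1) →
      (∀ n, tsupport (φ n : EuclideanSpace ℝ (Fin d) → ℂ) ⊆ Metric.closedBall 0 (r n)) →
      Tendsto r atTop (𝓝 0) →
      ∀ u : 𝓢(EuclideanSpace ℝ (Fin d), ℂ),
        Tendsto (fun n => Literature.Analysis.FunctionSpaces.SchwartzAverage.translationAverage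
          (ContinuousLinearMap.id ℝ (EuclideanSpace ℝ (Fin d))) (φ n) u) atTop (𝓝 u)) := by
  intro d φ r hnn hmass hsupp hr u
  rw [(schwartz_withSeminorms ℂ (EuclideanSpace ℝ (Fin d)) ℂ).tendsto_nhds]
  rintro ⟨k, l⟩ ε hε
  -- the radius below which every admissible weight gives `p_{k,l}(K_h u - u) ≤ ε / 2`
  obtain ⟨R, hR, hRε⟩ :=
    Literature.Analysis.FunctionSpaces.SchwartzAverage.exists_radius_seminorm_translationAverage_sub_le
      (ContinuousLinearMap.id ℝ (EuclideanSpace ℝ (Fin d))) u k l (half_pos hε)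
  -- eventually the supports of the `φ n` fit inside that radius
  filter_upwards [hr.eventually_lt_const hR] with n hn
  rw [SchwartzMap.schwartzSeminormFamily_apply]
  refine (hRε (φ n) (hmass n) (integral_norm_le_one_of_nonneg_of_mass_one (φ n) (hnn n) (hmass n))
    fun a ha => ?_).trans_lt (half_lt_self hε)
  refine image_eq_zero_of_notMem_tsupport fun hmem => ?_
  have hball := hsupp n hmem
  rw [Metric.mem_closedBall, dist_zero_right] at hball
  linarith

end Summit.QuantumFields.YangMills.Cruxes.ContinuumLegGivenGap.DualitySelectionNloSkewness
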